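import Literature.AlgebraicGeometry.Frobenioids.PerfectionCoAngular
import HarnessLib

/-!
# Frobenioids I, Proposition 3.2 (iii), first clause: the perfection of a Frobenioid of
# Frobenius-isotropic type is of isotropic type

Mochizuki, *The geometry of Frobenioids I: the general theory*, Kyushu J. Math. **62** (2008)
293–400, Definition 3.1 (iii) p. 57 ("Suppose that the Frobenioid `C` is of Frobenius-isotropic type")
and Proposition 3.2 (iii) p. 59 ("`C^pf` is a Frobenioid of perfect and isotropic type")
[cite: MochizukiFrdI2008, Prop. 3.2 (iii) p.59].

PROOF-ONLY companion of `PerfectionCoAngular.lean`.  For THE perfection `PreFrobenioidData.perfection hF`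
we prove the ISOTROPIC-TYPE clause of Prop. 3.2 (iii) under the printed standing hypothesis that `C` is of
Frobenius-isotropic type: an isometric pre-step `(A, n) → (B, m)` of `C^pf`, transported to a level
`(a·d, b·d)` where `d` is the degree of a Frobenius-type arrow `A → A′` with `A′` isotropic, is
represented by an isometric pre-step of `C` out of `A^{(a·d)}` — an isotropic object, being the target of
an arrow from `A′ ≅ A^{(d)}` (Def. 1.3 (vii)(b)) — hence by an isomorphism of `C`; so its class is an
isomorphism of `C^pf`.  Towards the PERFECT-TYPE clause we record its existence half: every object
`(B, m)` of `C^pf` is the codomain of an arrow of Frobenius type of any prescribed degree `n`, namely the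
"`n`-th power map" `(B, m·n) → (B, m)` represented by the transition `B^{(1)} → B^{(n)}` ("the pair
`(A, n)` is to be thought of as an `n`-th root of `A`").  The unique-lifting half of "perfect" and
`(C^pf)^pf ≃ C^pf` are not treated here.
-/

namespace Literature.AlgebraicGeometry.Frobenioids

namespace PreFrobenioid

namespace Perfection

open CategoryTheory Opposite

universe w v v' u u'

variable {D : Type u} [Category.{v} D] {Φ : Dᵒᵖ ⥤ CommMonCat.{w}}
  {C : Type u'} [Category.{v'} C] {F : C ⥤ ElemFrobenioid Φ}

/-- The chosen Frobenius powers `A^{(a)}` with `d ∣ a` are isotropic as soon as `A` admits a Frobenius-type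
arrow of degree `d` to an isotropic object (Def. 1.3 (ii) essential uniqueness and (vii)(b)).
[cite: MochizukiFrdI2008, Def. 1.3 (vii) p.25] -/
theorem isIsotropic_frobPow (hF : IsFrobenioid F) {A A' : C} {φ : A ⟶ A'} (hφ : IsFrobeniusType F φ)
    (hA' : IsIsotropic F A') {a : ℕ+} (h : PreFrobenioid.degFr F φ ∣ a) :
    IsIsotropic F (frobPow hF A a) := by
  obtain ⟨i, -⟩ := hF.ii_unique φ (frob hF A (PreFrobenioid.degFr F φ)) hφ
    (isFrobeniusType_frob hF A _) (by rw [degFr_frob])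
  exact hF.vii_b (frobTrans hF A h) (hF.vii_b i.hom hA')

/-- **Prop. 3.2 (iii), isotropic-type clause**, for THE perfection of a Frobenioid of Frobenius-isotropic
type: every isometric pre-step of `C^pf` is an isomorphism. [cite: MochizukiFrdI2008, Prop. 3.2 (iii) p.59] -/
theorem isOfIsotropicType_perfection (hF : IsFrobenioid F) (hiso : IsOfType (IsFrobeniusIsotropic F)) :
    (ops hF).IsOfIsotropicType := by
  refine ⟨fun X Y β hβ => ?_⟩
  obtain ⟨b, rfl⟩ := Hom.mk_surjective β
  obtain ⟨A', φ, hφ, hA'⟩ := hiso X.obj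
  -- transport to the level `(a·d, b·d)`, `d = deg_Fr(φ)`
  let L' : Level X Y := ⟨b.L.a * PreFrobenioid.degFr F φ, b.L.b * PreFrobenioid.degFr F φ,
    by rw [← mul_assoc, b.L.eq, mul_assoc]⟩
  have hle : b.L.LE L' := ⟨dvd_mul_right _ _, dvd_mul_right _ _⟩
  have hXa : IsIsotropic F (frobPow hF X.obj L'.a) := isIsotropic_frobPow hF hφ hA' (dvd_mul_left _ _)
  -- the transported representative is an isometric pre-step of `C` with isotropic domain
  have hdeg : PreFrobenioid.degFr F (Level.lift b.L L' hle b.hom) = 1 :=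
    (degFr_lift b.L L' hle b.hom).trans hβ.1.1
  have hbase : IsIso (Base F (Level.lift b.L L' hle b.hom)) := by
    apply (isIso_base_hom_iff ⟨L', _⟩).mpr
    have e := baseMap_lift b.L L' hle b.hom
    change IsIso (Rep.baseMap ⟨L', Level.lift b.L L' hle b.hom⟩)
    rw [e]
    exact hβ.1.2
  have hdiv : Div F (Level.lift b.L L' hle b.hom) = 1 := by
    apply (div_eq_one_iff ⟨L', _⟩).mp
    have e := div_lift b.L L' hle b.hom
    change Rep.div ⟨L', Level.lift b.L L' hle b.hom⟩ = 1
    rw [e]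
    exact hβ.2
  have hI : IsIso (Level.lift b.L L' hle b.hom) := hXa _ hdiv ⟨hdeg, hbase⟩
  rw [← Hom.mk_lift b L' hle]
  exact isIso_mk_of_isIso _ hI

/-! ### Roots: every object of `C^pf` is the codomain of Frobenius-type arrows of every degree -/

/-- The `n`-th power map `(B, m·n) → (B, m)` of `C^pf` — the class at level `(1, n)` of the transition
`B^{(1)} → B^{(n)}` — is an arrow of Frobenius type of Frobenius degree `n`; in particular every object of
`C^pf` has an "`n`-th root" (the existence half of "perfect", Def. 1.2 (iv), for `C^pf`).
[cite: MochizukiFrdI2008, Prop. 3.2 (iii) p.59] -/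
theorem exists_frobeniusType_to (hF : IsFrobenioid F) (Y : Perfection hF) (n : ℕ+) :
    ∃ (X : Perfection hF) (ρ : X ⟶ Y), (ops hF).IsFrobeniusType ρ ∧ (ops hF).degFr ρ = n := by
  let X : Perfection hF := ⟨Y.obj, Y.idx * n⟩
  let r : Rep X Y := ⟨⟨1, n, by change Y.idx * n * 1 = Y.idx * n; rw [mul_one]⟩,
    frobTrans hF Y.obj (one_dvd n)⟩
  have hfr := isFrobeniusType_frobTrans hF Y.obj (one_dvd n)
  refine ⟨X, Hom.mk r, ⟨⟨?_, (div_eq_one_iff r).mpr hfr.1.2⟩, (isIso_base_hom_iff r).mp hfr.2⟩, ?_⟩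
  · -- co-angular: every transport of `r` is a transition morphism, an arrow of Frobenius type of `C`
    refine isCoAngular_mk r fun L h => ?_
    have hab : L.a ∣ L.b :=
      Dvd.intro n (mul_left_cancel (a := Y.idx) ((show Y.idx * (L.a * n) = Y.idx * n * L.a by ac_rfl).trans L.eq))
    have key : frob hF Y.obj L.a ≫ Level.lift r.L L h r.hom = frob hF Y.obj L.b := by
      have sp := Level.lift_spec r.L L h r.hom
      change frobTrans hF Y.obj h.1 ≫ Level.lift r.L L h r.hom =
        frobTrans hF Y.obj (one_dvd n) ≫ frobTrans hF Y.obj h.2 at sp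
      rw [frobTrans_trans] at sp
      rw [← frob_frobTrans hF Y.obj h.1, Category.assoc, sp, frob_frobTrans]
    rw [frobTrans_unique hF Y.obj hab key]
    exact (isFrobeniusType_frobTrans hF Y.obj hab).1.1
  · change PreFrobenioid.degFr F (frobTrans hF Y.obj (one_dvd n)) = n
    have := degFr_frobTrans hF Y.obj (one_dvd n)
    rwa [one_mul] at this

end Perfection

end PreFrobenioid

end Literature.AlgebraicGeometry.Frobenioids
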